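import Summits.CriticalPhenomena.PercolationContinuityZ3.Theorems.Transplant.SharpnessGridPassage
import Summits.CriticalPhenomena.PercolationContinuityZ3.Theorems.Transplant.SharpnessGridCrossings
import Summits.CriticalPhenomena.PercolationContinuityZ3.Theorems.Transplant.SharpnessGridGlue
import HarnessLib

/-!
# Transplant sharpness XIII — fine realisation of hole-chain crossings and the paid vertical runs

builds on p205010 (kernel theorem, internal audit signed; external expert review pending).
Status sentence (coordinator 2026-08-20T04:30Z): "θ(p_c) = 0 on ℤ^d, all d ≥ 2 — kernel-verified (Lean 4/Mathlib,
standard axioms); internal adversarial audit SIGNED 2026-08-20 04:29Z; external expert review pending."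

Lane `prim-bschramm`, seat p5 (sharpness); memo HOME/prim-bschramm-p5-g20/GRIDWEDGE-PROOF-S8.md §8.1.  Module (M4b) of the
kernel route for the hard half of P5-SHARPNESS row 83.  Deterministic, PROVED:

* `exists_fineWalk_of_holeLR`, `exists_fineWalk_of_holeTB` — a hole-chain crossing of a cell rectangle whose cells are
  clear for `ω` is realised (M1c `openConnIn_dualConfig_of_coarse`) by a `dualConfig ω`-open walk of the dual lattice
  between the lower-left plaquettes of the end cells, inside the fine box of the rectangle;
* `exists_inCellRun`, `exists_fineWalk_of_holeTB_ext` — the in-cell vertical extension (top-anchored pieces);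
* `runTop`, `exists_upRun`, `exists_downRunFrom` — the paid straight dual runs above `t` / below `s`.
The arms themselves (`exists_upperArm`, `exists_lowerArm`) are in `SharpnessGridArms.lean`.

References: G. Grimmett, *Percolation*, 2nd ed. (1999), §11.7 (Fig. 11.27), §1.4; H. Kesten (1982) §2.2.
-/

namespace Summit.CriticalPhenomena.PercolationContinuityZ3.Theorems.TransplantSharpness

open Literature.Probability.Percolation Literature.Probability.LatticeModels SimpleGraph

/-! ## Fine realisation of hole-chain crossings -/

/-- The fine box of the cell rectangle `u + [0,m] × [0,n]` contains the plaquettes of its cells. [folklore] -/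
theorem cellFaces_subset_fineBox {M : ℕ} {u d : Site 2} {m n : ℕ}
    (hd : u 0 ≤ d 0 ∧ d 0 ≤ u 0 + m ∧ u 1 ≤ d 1 ∧ d 1 ≤ u 1 + n) :
    cellFaces M d ⊆ {z : Site 2 | (M : ℤ) * u 0 ≤ z 0 ∧ z 0 ≤ M * (u 0 + m) + M - 1 ∧
      (M : ℤ) * u 1 ≤ z 1 ∧ z 1 ≤ M * (u 1 + n) + M - 1} := by
  intro z hz
  have h0 := hz 0
  have h1 := hz 1
  have hM : (0 : ℤ) ≤ M := Nat.cast_nonneg M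
  refine ⟨?_, ?_, ?_, ?_⟩ <;> nlinarith [mul_le_mul_of_nonneg_left hd.1 hM, mul_le_mul_of_nonneg_left hd.2.1 hM,
    mul_le_mul_of_nonneg_left hd.2.2.1 hM, mul_le_mul_of_nonneg_left hd.2.2.2 hM]

/-- Coordinates of the lower-left plaquette `M d` of a cell. [folklore] -/
theorem smul_apply_eq (M : ℕ) (d : Site 2) (k : Fin 2) : ((M : ℤ) • d) k = (M : ℤ) * d k := by
  simp

/-- **Fine realisation of a left–right hole-chain crossing**: if the cells of `u + [0,m] × [0,n]` are clear for
`ω ⊆ E(ℤ²)` (`M ≥ 2`) and `ω ∈ holeLR M u m n`, there is a `dualConfig ω`-open dual walk from the column `M u₀` to the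
column `M (u₀ + m)` inside the fine box of the rectangle. [folklore] -/
theorem exists_fineWalk_of_holeLR {ω : BondConfig (Site 2)} (hω : ω ⊆ (zdGraph 2).edgeSet) {M : ℕ} (hM : 2 ≤ M)
    {u : Site 2} {m n : ℕ}
    (hclear : ∀ d : Site 2, u 0 ≤ d 0 → d 0 ≤ u 0 + m → u 1 ≤ d 1 → d 1 ≤ u 1 + n →
      ∀ e ∈ ω, ∀ v ∈ e, v ∉ cellInterior M d)
    (h : ω ∈ holeLR M u m n) :
    ∃ (x y : Site 2) (P : (zdGraph 2).Walk x y), x 0 = M * u 0 ∧ y 0 = M * (u 0 + m) ∧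
      (∀ z ∈ P.support, (M : ℤ) * u 0 ≤ z 0 ∧ z 0 ≤ M * (u 0 + m) + M - 1 ∧
        (M : ℤ) * u 1 ≤ z 1 ∧ z 1 ≤ M * (u 1 + n) + M - 1) ∧
      ∀ e ∈ P.edges, e ∈ dualConfig ω := by
  obtain ⟨xl, hxl, xr, hxr, hconn⟩ := h
  obtain ⟨a, ha, rfl⟩ := hxl
  obtain ⟨b, hb, rfl⟩ := hxr
  have ha' := Finset.mem_filter.1 (Finset.mem_coe.1 ha)
  have hb' := Finset.mem_filter.1 (Finset.mem_coe.1 hb)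
  have ha3 := mem_rectangle_iff.1 ha'.1
  have hb3 := mem_rectangle_iff.1 hb'.1
  set S : Set (Site 2) := {z : Site 2 | (M : ℤ) * u 0 ≤ z 0 ∧ z 0 ≤ M * (u 0 + m) + M - 1 ∧
      (M : ℤ) * u 1 ≤ z 1 ∧ z 1 ≤ M * (u 1 + n) + M - 1} with hS
  have hreal := openConnIn_dualConfig_of_coarse hω hM (𝒞 := (· + u) '' (↑(rectangle m n) : Set (Site 2))) (S := S)
    (fun d hd => by
      obtain ⟨d', hd', rfl⟩ := hd
      have := mem_rectangle_iff.1 (Finset.mem_coe.1 hd')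
      exact hclear (d' + u) (by simp; omega) (by simp; omega) (by simp; omega) (by simp; omega))
    (fun d hd => by
      obtain ⟨d', hd', rfl⟩ := hd
      have := mem_rectangle_iff.1 (Finset.mem_coe.1 hd')
      exact cellFaces_subset_fineBox (u := u) (m := m) (n := n) (by simp; omega)) hconn
  have hdE : dualConfig ω ⊆ (zdGraph 2).edgeSet := fun e he => (mem_dualConfig_iff.1 he).1
  obtain ⟨P, hPs, hPe⟩ := exists_walk_of_mem_openConnIn hdE hreal
  refine ⟨_, _, P, ?_, ?_, fun z hz => hPs z hz, hPe⟩
  · simp only [smul_apply_eq, Pi.add_apply, ha'.2, zero_add]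
  · simp only [smul_apply_eq, Pi.add_apply, hb'.2]; ring

/-- **Fine realisation of a bottom–top hole-chain crossing** (same, from the row `M u₁` to the row `M (u₁ + n)`). [folklore] -/
theorem exists_fineWalk_of_holeTB {ω : BondConfig (Site 2)} (hω : ω ⊆ (zdGraph 2).edgeSet) {M : ℕ} (hM : 2 ≤ M)
    {u : Site 2} {m n : ℕ}
    (hclear : ∀ d : Site 2, u 0 ≤ d 0 → d 0 ≤ u 0 + m → u 1 ≤ d 1 → d 1 ≤ u 1 + n →
      ∀ e ∈ ω, ∀ v ∈ e, v ∉ cellInterior M d)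
    (h : ω ∈ holeTB M u m n) :
    ∃ (x y : Site 2) (P : (zdGraph 2).Walk x y), x 1 = M * u 1 ∧ y 1 = M * (u 1 + n) ∧
      (∀ z ∈ P.support, (M : ℤ) * u 0 ≤ z 0 ∧ z 0 ≤ M * (u 0 + m) + M - 1 ∧
        (M : ℤ) * u 1 ≤ z 1 ∧ z 1 ≤ M * (u 1 + n) + M - 1) ∧
      ∀ e ∈ P.edges, e ∈ dualConfig ω := by
  obtain ⟨xb, hxb, xt, hxt, hconn⟩ := h
  obtain ⟨a, ha, rfl⟩ := hxb
  obtain ⟨b, hb, rfl⟩ := hxt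
  have ha' := Finset.mem_filter.1 (Finset.mem_coe.1 ha)
  have hb' := Finset.mem_filter.1 (Finset.mem_coe.1 hb)
  have ha3 := mem_rectangle_iff.1 ha'.1
  have hb3 := mem_rectangle_iff.1 hb'.1
  set S : Set (Site 2) := {z : Site 2 | (M : ℤ) * u 0 ≤ z 0 ∧ z 0 ≤ M * (u 0 + m) + M - 1 ∧
      (M : ℤ) * u 1 ≤ z 1 ∧ z 1 ≤ M * (u 1 + n) + M - 1} with hS
  have hreal := openConnIn_dualConfig_of_coarse hω hM (𝒞 := (· + u) '' (↑(rectangle m n) : Set (Site 2))) (S := S)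
    (fun d hd => by
      obtain ⟨d', hd', rfl⟩ := hd
      have := mem_rectangle_iff.1 (Finset.mem_coe.1 hd')
      exact hclear (d' + u) (by simp; omega) (by simp; omega) (by simp; omega) (by simp; omega))
    (fun d hd => by
      obtain ⟨d', hd', rfl⟩ := hd
      have := mem_rectangle_iff.1 (Finset.mem_coe.1 hd')
      exact cellFaces_subset_fineBox (u := u) (m := m) (n := n) (by simp; omega)) hconn
  have hdE : dualConfig ω ⊆ (zdGraph 2).edgeSet := fun e he => (mem_dualConfig_iff.1 he).1
  obtain ⟨P, hPs, hPe⟩ := exists_walk_of_mem_openConnIn hdE hreal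
  refine ⟨_, _, P, ?_, ?_, fun z hz => hPs z hz, hPe⟩
  · simp only [smul_apply_eq, Pi.add_apply, ha'.2, zero_add]
  · simp only [smul_apply_eq, Pi.add_apply, hb'.2]; ring

/-- **In-cell extension**: inside a cell `d` clear for `ω` (`M ≥ 2`), the straight dual run from the top-left plaquette
`(M d₀, M d₁ + M - 1)` down to the lower-left plaquette `M d` is `dualConfig ω`-open (every crossed edge has the interior
endpoint `(M d₀ + 1, r)`). [folklore] -/
theorem exists_inCellRun {ω : BondConfig (Site 2)} (hω : ω ⊆ (zdGraph 2).edgeSet) {M : ℕ} (hM : 2 ≤ M) (d : Site 2)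
    (hd : ∀ e ∈ ω, ∀ v ∈ e, v ∉ cellInterior M d) :
    ∃ Q : (zdGraph 2).Walk ((M : ℤ) • d) ![(M : ℤ) * d 0, M * d 1 + M - 1], (∀ x ∈ Q.edges, x ∈ dualConfig ω) ∧
      ∀ z ∈ Q.support, z 0 = (M : ℤ) * d 0 ∧ (M : ℤ) * d 1 ≤ z 1 ∧ z 1 ≤ M * d 1 + M - 1 := by
  set top : Site 2 := ![(M : ℤ) * d 0, M * d 1 + M - 1] with htop
  have hcast : ((M - 1 : ℕ) : ℤ) = (M : ℤ) - 1 := by rw [Nat.cast_sub (by omega)]; push_cast; ring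
  have hend : ((fun w : Site 2 => w - Pi.single 1 1)^[M - 1] top) = (M : ℤ) • d := by
    rw [Site.eq_iff_two, iterate_sub_single_apply_zero, iterate_sub_single_apply_one, hcast, smul_apply_eq,
      smul_apply_eq]
    simp [htop]
  refine ⟨((downRun top (M - 1)).copy rfl hend).reverse, fun x hx => ?_, fun z hz => ?_⟩
  · rw [Walk.edges_reverse, List.mem_reverse, Walk.edges_copy] at hx
    refine downRun_edges_mem_dualConfig hω (M - 1) top (fun w hw0 hw1 hw2 => ?_) x hx
    simp only [htop, Matrix.cons_val_zero, Matrix.cons_val_one, hcast] at hw0 hw1 hw2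
    refine not_mem_of_clear hd (Or.inr (Fin.forall_fin_two.2 ⟨?_, ?_⟩))
    · simp only [Pi.add_apply, Pi.single_eq_same, hw0]
      constructor <;> omega
    · simp only [Pi.add_apply, Pi.single_eq_of_ne (show (1 : Fin 2) ≠ 0 by decide), add_zero]
      constructor <;> linarith
  · rw [Walk.support_reverse, List.mem_reverse, Walk.support_copy, mem_support_downRun] at hz
    simp only [htop, Matrix.cons_val_zero, Matrix.cons_val_one, hcast] at hz
    exact ⟨hz.1, by linarith [hz.2.1], hz.2.2⟩

/-- **Fine realisation of a bottom–top hole-chain crossing, extended to the top fine row**: as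
`exists_fineWalk_of_holeTB`, but the walk ends on the row `M (u₁ + n) + M - 1` (realisation followed by the in-cell run
in the top cell). [folklore] -/
theorem exists_fineWalk_of_holeTB_ext {ω : BondConfig (Site 2)} (hω : ω ⊆ (zdGraph 2).edgeSet) {M : ℕ} (hM : 2 ≤ M)
    {u : Site 2} {m n : ℕ}
    (hclear : ∀ d : Site 2, u 0 ≤ d 0 → d 0 ≤ u 0 + m → u 1 ≤ d 1 → d 1 ≤ u 1 + n →
      ∀ e ∈ ω, ∀ v ∈ e, v ∉ cellInterior M d)
    (h : ω ∈ holeTB M u m n) :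
    ∃ (x y : Site 2) (P : (zdGraph 2).Walk x y), x 1 = M * u 1 ∧ y 1 = M * (u 1 + n) + M - 1 ∧
      (∀ z ∈ P.support, (M : ℤ) * u 0 ≤ z 0 ∧ z 0 ≤ M * (u 0 + m) + M - 1 ∧
        (M : ℤ) * u 1 ≤ z 1 ∧ z 1 ≤ M * (u 1 + n) + M - 1) ∧
      ∀ e ∈ P.edges, e ∈ dualConfig ω := by
  -- repeat the realisation with the top cell named
  obtain ⟨xb, hxb, xt, hxt, hconn⟩ := h
  obtain ⟨a, ha, rfl⟩ := hxb
  obtain ⟨b, hb, rfl⟩ := hxt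
  have ha' := Finset.mem_filter.1 (Finset.mem_coe.1 ha)
  have hb' := Finset.mem_filter.1 (Finset.mem_coe.1 hb)
  have ha3 := mem_rectangle_iff.1 ha'.1
  have hb3 := mem_rectangle_iff.1 hb'.1
  set S : Set (Site 2) := {z : Site 2 | (M : ℤ) * u 0 ≤ z 0 ∧ z 0 ≤ M * (u 0 + m) + M - 1 ∧
      (M : ℤ) * u 1 ≤ z 1 ∧ z 1 ≤ M * (u 1 + n) + M - 1} with hS
  have hreal := openConnIn_dualConfig_of_coarse hω hM (𝒞 := (· + u) '' (↑(rectangle m n) : Set (Site 2))) (S := S)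
    (fun d hd => by
      obtain ⟨d', hd', rfl⟩ := hd
      have := mem_rectangle_iff.1 (Finset.mem_coe.1 hd')
      exact hclear (d' + u) (by simp; omega) (by simp; omega) (by simp; omega) (by simp; omega))
    (fun d hd => by
      obtain ⟨d', hd', rfl⟩ := hd
      have := mem_rectangle_iff.1 (Finset.mem_coe.1 hd')
      exact cellFaces_subset_fineBox (u := u) (m := m) (n := n) (by simp; omega)) hconn
  have hdE : dualConfig ω ⊆ (zdGraph 2).edgeSet := fun e he => (mem_dualConfig_iff.1 he).1
  obtain ⟨P, hPs, hPe⟩ := exists_walk_of_mem_openConnIn hdE hreal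
  obtain ⟨Q, hQe, hQs⟩ := exists_inCellRun hω hM (b + u)
    (hclear (b + u) (by simp; omega) (by simp; omega) (by simp; omega) (by simp; omega))
  have hM0 : (0 : ℤ) ≤ M := Nat.cast_nonneg M
  refine ⟨_, _, P.append Q, ?_, ?_, fun z hz => ?_, fun e he => ?_⟩
  · simp only [smul_apply_eq, Pi.add_apply, ha'.2, zero_add]
  · simp only [Matrix.cons_val_one, Matrix.cons_val_zero, Pi.add_apply, hb'.2]; ring
  · rw [Walk.mem_support_append_iff] at hz
    rcases hz with hz | hz
    · exact hPs z hz
    · have := hQs z hz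
      simp only [Pi.add_apply] at this
      have hb0 := hb3.1; have hb1 := hb3.2.1
      refine ⟨by nlinarith [this.1], by nlinarith [this.1], by nlinarith [this.2.1, hb3.2.2.1], ?_⟩
      rw [hb'.2] at this; nlinarith [this.2.2]
  · rw [Walk.edges_append, List.mem_append] at he
    rcases he with he | he
    · exact hPe e he
    · exact hQe e he

/-! ## The paid vertical run -/

/-- The top of the upper run: the plaquette `(t₀, M (jt+5) - 1)`. House notation. -/
def runTop (M : ℕ) (t : Site 2) (jt : ℤ) : Site 2 := ![t 0, (M : ℤ) * (jt + 5) - 1]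

/-- The end of the `5M`-step run down from `runTop` is the plaquette `(t₀, M jt - 1)`. [folklore] -/
theorem iterate_runTop_eq (M : ℕ) (t : Site 2) (jt : ℤ) (ht : t 1 = (M : ℤ) * jt - 1) :
    ((fun w : Site 2 => w - Pi.single 1 1)^[5 * M] (runTop M t jt)) = t := by
  rw [Site.eq_iff_two, iterate_sub_single_apply_zero, iterate_sub_single_apply_one]
  refine ⟨by simp [runTop], ?_⟩
  simp only [runTop, Matrix.cons_val_one, Matrix.cons_val_zero, ht]
  push_cast; ring

/-- **The upper run as an open dual walk from `t` up to `runTop`**: if none of the horizontal primal edges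
`{(t₀,r), (t₀+1,r)}`, `M jt ≤ r ≤ M(jt+5) - 1`, lies in `ω`, the straight dual walk is `dualConfig ω`-open; its vertices
are the plaquettes `(t₀, r)`, `M jt - 1 ≤ r ≤ M (jt+5) - 1`. [folklore] -/
theorem exists_upRun {ω : BondConfig (Site 2)} (hω : ω ⊆ (zdGraph 2).edgeSet) (M : ℕ) (t : Site 2) (jt : ℤ)
    (ht : t 1 = (M : ℤ) * jt - 1)
    (hrun : ∀ r : ℤ, (M : ℤ) * jt ≤ r → r ≤ M * (jt + 5) - 1 → s(![t 0, r], ![t 0, r] + Pi.single 0 1) ∉ ω) :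
    ∃ Q : (zdGraph 2).Walk t (runTop M t jt), (∀ e ∈ Q.edges, e ∈ dualConfig ω) ∧
      ∀ z ∈ Q.support, z 0 = t 0 ∧ (M : ℤ) * jt - 1 ≤ z 1 ∧ z 1 ≤ M * (jt + 5) - 1 := by
  set D := downRun (runTop M t jt) (5 * M) with hD
  have hend := iterate_runTop_eq M t jt ht
  refine ⟨(D.copy rfl hend).reverse, fun e he => ?_, fun z hz => ?_⟩
  · rw [Walk.edges_reverse, List.mem_reverse, Walk.edges_copy] at he
    refine downRun_edges_mem_dualConfig hω (5 * M) (runTop M t jt) (fun w hw0 hw1 hw2 => ?_) e he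
    simp only [runTop, Matrix.cons_val_zero, Matrix.cons_val_one] at hw0 hw1 hw2
    push_cast at hw1
    have hw : w = ![t 0, w 1] := by
      rw [Site.eq_iff_two]; simp [hw0]
    rw [hw]
    exact hrun (w 1) (by linarith) hw2
  · rw [Walk.support_reverse, List.mem_reverse, Walk.support_copy, mem_support_downRun] at hz
    simp only [runTop, Matrix.cons_val_zero, Matrix.cons_val_one] at hz
    push_cast at hz
    refine ⟨hz.1, by linarith [hz.2.1], hz.2.2⟩

/-- **The lower run**: the straight dual walk DOWN from `s` (`s₁ = M (jb+2) - 1`) to the row `M (jb-4)` is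
`dualConfig ω`-open when none of the horizontal primal edges `{(s₀,r),(s₀+1,r)}`, `M(jb-4)+1 ≤ r ≤ M(jb+2)-1`, is in `ω`.
[folklore] -/
theorem exists_downRunFrom {ω : BondConfig (Site 2)} (hω : ω ⊆ (zdGraph 2).edgeSet) {M : ℕ} (hM : 1 ≤ M)
    (s : Site 2) (jb : ℤ) (hs : s 1 = (M : ℤ) * (jb + 2) - 1)
    (hrun : ∀ r : ℤ, (M : ℤ) * (jb - 4) + 1 ≤ r → r ≤ M * (jb + 2) - 1 → s(![s 0, r], ![s 0, r] + Pi.single 0 1) ∉ ω) :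
    ∃ (e : Site 2) (Q : (zdGraph 2).Walk s e), e 0 = s 0 ∧ e 1 = (M : ℤ) * (jb - 4) ∧
      (∀ x ∈ Q.edges, x ∈ dualConfig ω) ∧
      ∀ z ∈ Q.support, z 0 = s 0 ∧ (M : ℤ) * (jb - 4) ≤ z 1 ∧ z 1 ≤ M * (jb + 2) - 1 := by
  have hcast : ((6 * M - 1 : ℕ) : ℤ) = 6 * (M : ℤ) - 1 := by
    rw [Nat.cast_sub (by omega)]; push_cast; ring
  refine ⟨_, downRun s (6 * M - 1), by simp, ?_, fun x hx => ?_, fun z hz => ?_⟩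
  · rw [iterate_sub_single_apply_one, hcast, hs]; ring
  · refine downRun_edges_mem_dualConfig hω (6 * M - 1) s (fun w hw0 hw1 hw2 => ?_) x hx
    rw [hcast, hs] at hw1
    rw [hs] at hw2
    have hw : w = ![s 0, w 1] := by rw [Site.eq_iff_two]; simp [hw0]
    rw [hw]
    exact hrun (w 1) (by linarith) hw2
  · rw [mem_support_downRun, hcast, hs] at hz
    exact ⟨hz.1, by linarith [hz.2.1], hz.2.2⟩

end Summit.CriticalPhenomena.PercolationContinuityZ3.Theorems.TransplantSharpness
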